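import Literature.MathematicalPhysics.QuantumFieldTheory.Balaban1983to89.B9Eq3124HZKnitPairReg335Y
import Literature.MathematicalPhysics.QuantumFieldTheory.Balaban1983to89.B7UnitaryAveragesAllRadii
import Literature.MathematicalPhysics.QuantumFieldTheory.Balaban1983to89.Node00.OpsYCubeDirInverseSymm
import Literature.MathematicalPhysics.QuantumFieldTheory.Balaban1983to89.B9Thm311DeltaPrimeSymm

/-!
# [B9] (3.19): THE KNIT TRANSPORTERS `U(Γ^{(j)}_{y,x})` OF A `U(N)`-VALUED BACKGROUND ARE `U(N)`-VALUED — AT EVERY BACKGROUND, NO REGULARITY WINDOW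

[Balaban1985BackgroundPropagators] (3.19) p. 393: the averaging operations of the background propagators transport along the contours
`Γ^{(j)}_{y,x}` with the gauge field `U` (*"with values in G"*, p. 390, `G = U(N)` or a closed subgroup); the contour variables `U(Γ^{(j)}_{y,x})` are
products of averaged bond variables `Ū^{i}`, `i ≤ j` ([Balaban1985Averaging] (42)–(43) pp. 23–24), hence lie in `G` — tacit in print.

WHY THIS FILE.  In the tree the knit's site transporter is def-Y's letter `parKnitY i U` (`B9B8AveragingJunction`): legs `knitT i (bgT (ℓ+1) (liftCfg U)) w =
compT …` of the level transporters `bgT L U₀ j y x = (Ū^j)(Γ_{y,x})` of the iterated [B7] averages `avgIter`.  Their `U(N)`-valuedness was typed only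
INSIDE [B7] Prop. 2's window (`B9Eq3124HZKnitPairReg335Y.knitT_mem_unitary_of_reg335P` ∕ `parKnitY_mem_unitary_of_reg335P`: on the class (3.35) with
`K_pl·L⁴ < α₀′`, `C₀α₀′ ≤ 1/3`, …), because `B7Prop2Explicit.avgIter_mem` needs `|Ū^i(∂p) − 1|` small to know that the series logarithm (21) of a unitary
is skew.  `B7UnitaryAveragesAllRadii` removes the window ((22)–(23) at every radius ⇒ `avgIter_mem_unitaryUnits_all`), so HERE: for EVERY `U(N)`-valued
configuration `U` the knit legs and the table `parKnitY i U` are `U(N)`-valued (§1), and consequently the symmetry clauses of the N06 letters at the knit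
transporter — `Δ′_a(U; parKnitY)`, `Δ′_{a,□}`, `G′_□`, and def-Y's Dirichlet cube inverse `G′_{□,S}` (`Node00.OpsYCubeDirInverse.GpDirY`) — hold for every
`G`-valued `U`, `G ≤ U(N)`, with NO hypothesis on the legs (§2): the `hpar : ∀ z w, parKnitY i U z w ∈ G` binder of ✓`GpCubeY_parKnitY_isSymmTr`,
✓`GpDirY_parKnitY_isSymmTr`, ✓`symm0_parKnitY`, … is discharged at `G := U(N)`.  This is the consumer dag-n06-d's «(Q-sym)» need for the `hOsym` row of
the KE head `BalabanUVNodesN06AtOpsYSectEStKnitRecordKE…` with `O := GpDirY` (fleet INBOX I.12423).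

* §1 `bgT_liftCfg_mem_unitaryUnits`, ★ `knitT_mem_unitaryUnits`, ★★ `parKnitY_mem_unitaryUnits` (every `U(N)`-valued `U`; no window),
  `parKnitY_mem_unitaryUnits_of_le`, `coe_parKnitY_mem_unitary`.
* §2 ★ `deltaPrimeAY_parKnitY_isSymmTr_of_le`, `deltaPrimeACubeY_parKnitY_isSymmTr_of_le`, ★ `GpCubeY_parKnitY_isSymmTr_of_le`,
  ★★ `GpDirY_parKnitY_isSymmTr_of_le` (the `hOsym` row for `O := GpDirY`, every exterior `S`, every `G`-valued `U`).

HONEST: bookkeeping over `B7UnitaryAveragesAllRadii` (elementary) and the tree's symmetry lemmas; the legs are shown `U(N)`-valued, NOT `G`-valued for a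
general closed subgroup `G < U(N)` (that needs `G` averaging-closed, [B7] Prop. 2's window — unchanged); no estimate of [B9] is discharged; nothing
continuum ∕ OS ∕ Clay.
-/

namespace Literature.MathematicalPhysics.QuantumFieldTheory.Balaban1983to89.B9KnitTransporterUnitaryY

open B7Prop2Explicit (unitaryUnits mem_unitaryUnits)
open B8Eq119TwistedAxial (bgT)
open B6KLevelCensusIndexV1 (KIdx)
open B6Cover236MultiLevelBlocks (cubes)
open B9B8CarrierDictionary (liftCfg liftCfg_mem)
open B9B8KnitLetterRegular (compT_mem)
open B9B8AveragingJunction (knitT parOfT parKnitY parKnitY_inv)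
open B9Thm311ReadingCoords (IsSymmTr)
open B9Thm311DeltaPrimeSymm (deltaPrimeAY_isSymmTr_of_inv_symm)
open B9Thm311CubeLettersFirstThree (deltaPrimeACubeY_isSymmTr_of_inv_symm GpCubeY_isSymmTr)
open B9CubeLettersOpsL0 (deltaPrimeACubeY GpCubeY)
open B7UnitaryAveragesAllRadii (hol_avgIter_mem_unitaryUnits_all)
open Node00
open Node00.OpsYCubeDirInverse (GpDirY)
open Node00.OpsYCubeDirInverseSymm (GpDirY_parKnitY_isSymmTr)

noncomputable section

open scoped Matrix Matrix.Norms.L2Operator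

variable {d ℓ : ℕ} {hd : 1 ≤ d + 1} {hL : Odd (ℓ + 1) ∧ 1 < ℓ + 1} {b₀ b₁ : ℝ} {N : ℕ}
variable (i : KIdx d ℓ hd hL b₀ b₁) {G : Subgroup (Matrix (Fin N) (Fin N) ℂ)ˣ}

/-! ## §1 The knit legs of a `U(N)`-valued background are `U(N)`-valued -/

/-- the level transporters `(Ū^j)(Γ_{y,x})` of the periodic lift of a `U(N)`-valued `U` are `U(N)`-valued — every level `j`, no window.
[cite: Balaban1985BackgroundPropagators, (3.19) p.393; Balaban1985Averaging, (43) p.24] -/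
theorem bgT_liftCfg_mem_unitaryUnits {U : CfgY (Matrix (Fin N) (Fin N) ℂ) i} (hU : ∀ μ x, U μ x ∈ unitaryUnits (Matrix (Fin N) (Fin N) ℂ))
    (j : ℕ) (y x : B7Prop1Explicit.Site (d + 1)) : bgT (ℓ + 1) (liftCfg U) j y x ∈ unitaryUnits (Matrix (Fin N) (Fin N) ℂ) :=
  hol_avgIter_mem_unitaryUnits_all (ℓ + 1) (fun z μ => liftCfg_mem hU z μ) j _ _

/-- ★ **THE KNIT TRANSPORTER TO EVERY SITE IS `U(N)`-VALUED**, for every `U(N)`-valued background (compare ✓`knitT_mem_unitary_of_reg335P`: inside the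
(3.35) ∕ [B7] Prop-2 window only). [cite: Balaban1985BackgroundPropagators, (3.19) p.393, p.390] -/
theorem knitT_mem_unitaryUnits {U : CfgY (Matrix (Fin N) (Fin N) ℂ) i} (hU : ∀ μ x, U μ x ∈ unitaryUnits (Matrix (Fin N) (Fin N) ℂ)) (w : SiteY i) :
    knitT i (bgT (ℓ + 1) (liftCfg U)) w ∈ unitaryUnits (Matrix (Fin N) (Fin N) ℂ) := by
  unfold knitT
  exact compT_mem (ℓ + 1) _ (fun j' _ y x => bgT_liftCfg_mem_unitaryUnits i hU j' y x) _ _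

/-- ★★ **THE KNIT SITE TRANSPORTER TABLE `parKnitY i U` IS `U(N)`-VALUED** for EVERY `U(N)`-valued `U` (a leg, an inverse leg, or `1`) — the window-free
twin of ✓`parKnitY_mem_unitary_of_reg335P`. [cite: Balaban1985BackgroundPropagators, (3.19) p.393, (3.24)–(3.25) pp.394–395] -/
theorem parKnitY_mem_unitaryUnits {U : CfgY (Matrix (Fin N) (Fin N) ℂ) i} (hU : ∀ μ x, U μ x ∈ unitaryUnits (Matrix (Fin N) (Fin N) ℂ))
    (z w : SiteY i) : parKnitY i U z w ∈ unitaryUnits (Matrix (Fin N) (Fin N) ℂ) := by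
  have hk := fun w => knitT_mem_unitaryUnits i hU w
  show parOfT i (bgT (ℓ + 1) (liftCfg U)) z w ∈ _
  unfold parOfT
  split_ifs
  · exact hk w
  · exact (unitaryUnits _).inv_mem (hk z)
  · exact (unitaryUnits _).one_mem

/-- for a `G`-valued `U`, `G ≤ U(N)`: the knit table is `U(N)`-valued. [cite: Balaban1985BackgroundPropagators, (3.19) p.393, p.390] -/
theorem parKnitY_mem_unitaryUnits_of_le (hGU : G ≤ unitaryUnits (Matrix (Fin N) (Fin N) ℂ)) {U : CfgY (Matrix (Fin N) (Fin N) ℂ) i}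
    (hU : ∀ μ x, U μ x ∈ G) (z w : SiteY i) : parKnitY i U z w ∈ unitaryUnits (Matrix (Fin N) (Fin N) ℂ) :=
  parKnitY_mem_unitaryUnits i (fun μ x => hGU (hU μ x)) z w

/-- matrix edition: `U(Γ_{z,w})⋆ U(Γ_{z,w}) = 1`. [cite: Balaban1985BackgroundPropagators, (3.19) p.393, bookkeeping] -/
theorem coe_parKnitY_mem_unitary {U : CfgY (Matrix (Fin N) (Fin N) ℂ) i} (hU : ∀ μ x, U μ x ∈ unitaryUnits (Matrix (Fin N) (Fin N) ℂ))
    (z w : SiteY i) : ((parKnitY i U z w : (Matrix (Fin N) (Fin N) ℂ)ˣ) : Matrix (Fin N) (Fin N) ℂ) ∈ unitary (Matrix (Fin N) (Fin N) ℂ) :=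
  mem_unitaryUnits.mp (parKnitY_mem_unitaryUnits i hU z w)

/-! ## §2 The symmetry clauses at the knit transporter, for every `G`-valued background (`G ≤ U(N)`), no hypothesis on the legs -/

/-- ★ `Δ′_a(U; parKnitY)` is symmetric for the trace pairing at every `G`-valued `U`, `G ≤ U(N)` (✓`symm0_parKnitY` with its `hpar` discharged).
[cite: Balaban1985BackgroundPropagators, (3.24) p.394, Thm 3.11 p.416] -/
theorem deltaPrimeAY_parKnitY_isSymmTr_of_le (hGU : G ≤ unitaryUnits (Matrix (Fin N) (Fin N) ℂ)) {U : CfgY (Matrix (Fin N) (Fin N) ℂ) i}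
    (hU : ∀ μ x, U μ x ∈ G) : IsSymmTr (fun _ => (1 : ℝ)) (deltaPrimeAY i (parKnitY i) U) :=
  deltaPrimeAY_isSymmTr_of_inv_symm i le_rfl (parKnitY i) U (parKnitY_inv i U) (parKnitY_mem_unitaryUnits_of_le i hGU hU)
    (fun μ x => hGU (hU μ x))

variable (q : ↥(cubes (toKT i).D.toDomains))

/-- `Δ′_{a,□}(U; parKnitY)` is symmetric at every `G`-valued `U`, `G ≤ U(N)`. [cite: Balaban1985BackgroundPropagators, (3.24) p.394, p.409] -/
theorem deltaPrimeACubeY_parKnitY_isSymmTr_of_le (hGU : G ≤ unitaryUnits (Matrix (Fin N) (Fin N) ℂ)) {U : CfgY (Matrix (Fin N) (Fin N) ℂ) i}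
    (hU : ∀ μ x, U μ x ∈ G) : IsSymmTr (fun _ => (1 : ℝ)) (deltaPrimeACubeY i q (parKnitY i) U) :=
  deltaPrimeACubeY_isSymmTr_of_inv_symm i q le_rfl (parKnitY i) U (parKnitY_inv i U) (parKnitY_mem_unitaryUnits_of_le i hGU hU)
    (fun μ x => hGU (hU μ x))

/-- ★ `G′_□(U; parKnitY)` is symmetric at every `G`-valued `U`, `G ≤ U(N)` (✓`GpCubeY_parKnitY_isSymmTr` with its `hpar` discharged).
[cite: Balaban1985BackgroundPropagators, (3.25) p.394, p.409, Thm 3.11 p.416] -/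
theorem GpCubeY_parKnitY_isSymmTr_of_le (hGU : G ≤ unitaryUnits (Matrix (Fin N) (Fin N) ℂ)) {U : CfgY (Matrix (Fin N) (Fin N) ℂ) i}
    (hU : ∀ μ x, U μ x ∈ G) : IsSymmTr (fun _ => (1 : ℝ)) (GpCubeY i q (parKnitY i) U) :=
  GpCubeY_isSymmTr i q (parKnitY i) U (deltaPrimeACubeY_parKnitY_isSymmTr_of_le i q hGU hU)

/-- ★★ **THE `hOsym` ROW FOR `O := G′_{□,S}` (def-Y's `GpDirY`), UNCONDITIONAL IN THE LEGS**: for every exterior `S`, every `G`-valued `U` with `G ≤ U(N)`,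
`GpDirY i □ parKnitY S U` is symmetric for the trace pairing (✓`Node00.OpsYCubeDirInverseSymm.GpDirY_parKnitY_isSymmTr` at `G := U(N)`, legs by §1).
[cite: Balaban1985BackgroundPropagators, (3.24)–(3.25) p.394, p.409, Thm 3.11 p.416] -/
theorem GpDirY_parKnitY_isSymmTr_of_le (hGU : G ≤ unitaryUnits (Matrix (Fin N) (Fin N) ℂ)) (S : Finset (SiteY i))
    {U : CfgY (Matrix (Fin N) (Fin N) ℂ) i} (hU : ∀ μ x, U μ x ∈ G) : IsSymmTr (fun _ => (1 : ℝ)) (GpDirY i q (parKnitY i) S U) :=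
  GpDirY_parKnitY_isSymmTr i q le_rfl S (fun μ x => hGU (hU μ x)) (parKnitY_mem_unitaryUnits_of_le i hGU hU)

end

end Literature.MathematicalPhysics.QuantumFieldTheory.Balaban1983to89.B9KnitTransporterUnitaryY
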